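import Mathlib.Algebra.Field.ULift
import Literature.AnabelianGeometry.AbsoluteAnabelian.AbsTopI.RelativeGCInputs
import Literature.AnabelianGeometry.AbsoluteAnabelian.GaloisTheatersNonVacuity
import Literature.AnabelianGeometry.AbsoluteAnabelian.SubpadicExamples
import HarnessLib

/-!
# [AbsTopI] Def 4.6 (ii) / Example 4.8 (ii) as the schemata `RelHomDGC`, `RelIsomDGC`, `Ex_4_8_ii`
# (FACT-LIST F-0196, F-0197, F-0194): the universal closures are REFUTABLE; the instance forms hold
# at the one-field point class

S. Mochizuki, *Topics in Absolute Anabelian Geometry I: Generalities* [MochizukiAbsTopI2012], §4: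
Definition 4.6 (ii) pp. 55–56 ("the rel-isom-DGC holds" / "the rel-hom-DGC holds") and Example 4.8 (ii)
p. 58 (hyperbolic orbicurves over sub-`p`-adic fields: "The hypotheses of Theorem 4.7, (iii), (iv), are
satisfied relative to this `𝒟`").

PROOF-ONLY negative-knowledge / non-vacuity file (no definition, no instance, no structure) next to
`AbsTopI/RelativeGC.lean` (abc-iut-L4-t13, never edited here); abc-iut cell seat abc-iut-f-057, block F,
FACT-LIST rows **F-0196** `ConstructionDataClass.RelHomDGC`, **F-0197** `ConstructionDataClass.RelIsomDGC`,
**F-0194** `ConstructionDataClass.Ex_4_8_ii` (class `preparatory`, kernel_closedness `parametrised`).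

All three rows are PREDICATES on an abstract `𝒟 : ConstructionDataClass` — an INTERFACE whose
`RelativeAnabelianDatum` fields (objects, scheme morphisms `Hom`, the flag `IsIso`, "the natural map"
`f ↦ [π₁(f)]`) carry no axiom (`RelativeGrothendieckConjecture.lean`: "a junk datum falsifies only its
own instance").  Definition 4.6 (ii) is a DEFINITION in print, and Example 4.8 (ii) asserts its clauses for
ONE class (the étale-`π₁` class of hyperbolic orbicurves over sub-`p`-adic fields, which the tree cannot
construct — abc-iut FOUNDATIONS row 12).  This file supplies the kernel objects deciding the rows AS
SCHEMATA:

* `exists_not_relHomDGC` / `not_forall_relHomDGC` (F-0196), `exists_not_relIsomDGC` /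
  `not_forall_relIsomDGC` (F-0197): at the one-field class over `ℚ` whose datum has NO scheme morphisms
  over the point extension `Π = G_ℚ ↠ G_ℚ`, the identity outer homomorphism is open and an isomorphism
  but has no preimage — the universal closures are FALSE;
* `exists_isEx48ClassSub_not_ex_4_8_ii` / `not_forall_ex_4_8_ii_prime` / `not_forall_ex_4_8_ii`
  (F-0194): the same class SATISFIES the typed hypothesis `IsEx48ClassSub p` of Example 4.8 (ii) (`ℚ` is
  sub-`p`-adic for every `p`, `Σ = Primes`, members = the objects flagged hyperbolic orbicurves) and is
  chain-full, yet violates the rel-hom-DGC clause — so the universal closure of `Ex_4_8_ii` is FALSE for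
  EVERY prime `p`;
* tightness of the cell's PROVED reductions: `exists_relHomDGC_not_relIsomDGC` — without the
  functoriality datum of `relIsomDGC_of_relHomDGC` (`RelativeGCFunctoriality.lean`) the rel-hom-DGC does
  NOT imply the rel-isom-DGC at the interface level (one morphism flagged non-iso whose image is the
  identity); `exists_isEx48ClassSub_relHomDGC_not_isChainFull` — the chain-fullness hypothesis of
  `ex_4_8_ii_of_relHomDGC` (`RelativeGCInputs.lean`) is not implied by the other typed clauses (a chain
  term that is not a member);
* instance form / non-vacuity: `exists_isEx48ClassSub_ex_4_8_ii` — the one-field POINT class over `ℚ`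
  with one scheme morphism (the identity) satisfies `IsEx48ClassSub p` NON-VACUOUSLY together with all
  four clauses of `Ex_4_8_ii p` (chain-full, rel-hom-DGC, `χ_p` open, `G_ℚ` slim — the last two being the
  cell's kernel theorems via `ex_4_8_ii_of_relHomDGC`), and the rel-isom-DGC.  HONEST LABEL: DEGENERATE
  (`Δ = 1`, tautological 'GC' over the point, cf. `GaloisTheatersNonVacuity.lean`); nothing about curves.

Consequently F-0194 / F-0196 / F-0197 are admissible ONLY in instance form — per class `𝒟`, as the
hypotheses `(h : 𝒟.RelHomDGC)` etc. of the consumers (`SemiAbsoluteChainsHyp.lean`,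
`AbsTopII/CuspidalizationInputs.lean`, …) or through the proved reductions — never as closed schemata
`∀ 𝒟, …` (a conditional certificate binding one of them would be vacuous).  Refuted-as-schema is a
statement about OUR typing, not about print, whose statements are the instances; refereed pre-IUT
material; nothing here bears on [IUTchIII] Cor. 3.12 or takes a side; typed ≠ proved.
-/

universe u

namespace Literature.AnabelianGeometry.AbsoluteAnabelian.AbsTopI.ConstructionDataClass

open AugmentedProfiniteGrp

/-! ### The base field `ℚ` (lifted to universe `u`) -/

/-- `ULift ℚ` has characteristic zero (transport along `ULift.ringEquiv`). [folklore] -/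
private theorem charZero_ulift_rat : CharZero (ULift.{u} ℚ) :=
  (ULift.ringEquiv : ULift.{u} ℚ ≃+* ℚ).toRingHom.charZero

/-- `ULift ℚ` is sub-`p`-adic for every prime `p`: `ℚ ↪ ℚ_p` is an embedding into a finitely generated
extension of `ℚ_p` ([pGC] Def 15.4 (i), example (2) p. 77, the case `ℚ`; cf.
`AbsTopIII.IsSubpadicFor.of_numberField`). [cite: MochizukiLocAn1999, Def 15.4 (i) p.77] -/
private theorem isSubpadicFor_ulift_rat (p : ℕ) [Fact p.Prime] :
    AbsTopIII.IsSubpadicFor (ULift.{u} ℚ) p := by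
  obtain ⟨⟨L, iL, aL, hfg, ⟨f⟩⟩⟩ := AbsTopIII.IsSubpadicFor.padic p
  exact ⟨⟨L, iL, aL, hfg,
    ⟨f.comp ((algebraMap ℚ ℚ_[p]).comp (ULift.ringEquiv : ULift.{u} ℚ ≃+* ℚ).toRingHom)⟩⟩⟩

/-! ### F-0196 / F-0197: the universal closures of `RelHomDGC` and `RelIsomDGC` are false -/

/-- **F-0196 as a schema is false at an explicit class**: the one-field class over `ℚ` (every object a
member and a hyperbolic orbicurve, no chain terms — so it is chain-full) whose datum over the point
extension `Π = G_ℚ ↠ G_ℚ` has NO scheme morphisms violates the rel-hom-DGC: the identity outer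
homomorphism `[id] : Π → Π` over `G_ℚ` is open but is not `[π₁(f)]` for any `f`.  (Print's Def 4.6 (ii)
is a definition; the class of Example 4.8 (ii), where [pGC] Thm A supplies the property, is not this
junk class.) [cite: MochizukiAbsTopI2012, Def 4.6 (ii) p.56] -/
theorem exists_not_relHomDGC :
    ∃ 𝒟 : ConstructionDataClass.{u}, (∀ b X, 𝒟.Mem b X) ∧ 𝒟.IsChainFull ∧
      ¬ Literature.AnabelianGeometry.AbsoluteAnabelian.AbsTopI.ConstructionDataClass.RelHomDGC 𝒟 := by
  haveI : CharZero (ULift.{u} ℚ) := charZero_ulift_rat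
  -- the point extension `Π = G ↠ G` over `G = G_ℚ` and its identity endomorphism over `G`
  let G : ProfiniteGrp.{u} := absoluteGaloisGrp (ULift.{u} ℚ)
  let A : AugmentedProfiniteGrp G :=
    { arith := G, aug := ContinuousMonoidHom.id G, aug_surjective := Function.surjective_id }
  let ι : A.HomOver A := ⟨ContinuousMonoidHom.id _, fun _ => rfl⟩
  -- the datum with one object and NO scheme morphisms
  let D : RelativeAnabelianDatum G :=
    { Obj := PUnit.{u + 1}, Hom := fun _ _ => PEmpty.{u + 1}, IsIso := fun _ => True,
      IsHyperbolicCurve := fun _ => True, primes := Set.univ, grp := fun _ => A,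
      outerHom := fun f => nomatch f }
  refine ⟨{ Base := PUnit.{u + 1}
            fld := fun _ => ULift.{u} ℚ
            instField := fun _ => inferInstance
            instCharZero := fun _ => inferInstance
            datum := fun _ => D
            Mem := fun _ _ => True
            IsHyperbolicOrbicurve := fun _ _ => True
            isHyperbolicOrbicurve_of_isHyperbolicCurve := fun _ _ _ => trivial
            chainTerms := fun _ _ => ∅ }, fun _ _ => trivial, ?_, fun h => ?_⟩
  · intro _ _ _ _ ht
    exact ht.elim
  · -- the identity outer homomorphism is open, hence should have a preimage: it has none
    have hopen : OuterHom.mk ι ∈ {c : A.OuterHom A | c.IsOpen} := by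
      show (OuterHom.mk ι).IsOpen
      have hr : Set.range ι.toHom = Set.univ := Set.range_eq_univ.mpr Function.surjective_id
      rw [OuterHom.isOpen_mk, HomOver.IsOpenHom, hr]
      exact isOpen_univ
    obtain ⟨f, -, -⟩ := (h PUnit.unit PUnit.unit PUnit.unit trivial trivial).surjOn hopen
    exact PEmpty.elim f

/-- **FACT-LIST F-0196, universal closure REFUTED**: it is NOT the case that every class of construction
data satisfies the rel-hom-DGC of [AbsTopI] Def 4.6 (ii).  Admissible form of the row: per class, as the
hypothesis `(h : 𝒟.RelHomDGC)` (for the class of Example 4.8 (ii) it is [pGC] Thm A, `pGC.ThmA`, on curve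
members: `relHomGC_curves_of_thmA`). [cite: MochizukiAbsTopI2012, Def 4.6 (ii) p.56] -/
theorem not_forall_relHomDGC :
    ¬ ∀ 𝒟 : ConstructionDataClass.{u},
      Literature.AnabelianGeometry.AbsoluteAnabelian.AbsTopI.ConstructionDataClass.RelHomDGC 𝒟 := by
  obtain ⟨𝒟, -, -, h⟩ := exists_not_relHomDGC.{u}
  exact fun H => h (H 𝒟)

/-- **F-0197 as a schema is false at an explicit class**: the same one-field class over `ℚ` with NO
scheme morphisms violates the rel-isom-DGC: the identity outer isomorphism of `Π = G_ℚ` over `G_ℚ` is not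
`[π₁(f)]` for any isomorphism `f`. [cite: MochizukiAbsTopI2012, Def 4.6 (ii) p.56] -/
theorem exists_not_relIsomDGC :
    ∃ 𝒟 : ConstructionDataClass.{u}, (∀ b X, 𝒟.Mem b X) ∧ 𝒟.IsChainFull ∧
      ¬ Literature.AnabelianGeometry.AbsoluteAnabelian.AbsTopI.ConstructionDataClass.RelIsomDGC 𝒟 := by
  haveI : CharZero (ULift.{u} ℚ) := charZero_ulift_rat
  let G : ProfiniteGrp.{u} := absoluteGaloisGrp (ULift.{u} ℚ)
  let A : AugmentedProfiniteGrp G :=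
    { arith := G, aug := ContinuousMonoidHom.id G, aug_surjective := Function.surjective_id }
  let ι : A.HomOver A := ⟨ContinuousMonoidHom.id _, fun _ => rfl⟩
  let D : RelativeAnabelianDatum G :=
    { Obj := PUnit.{u + 1}, Hom := fun _ _ => PEmpty.{u + 1}, IsIso := fun _ => True,
      IsHyperbolicCurve := fun _ => True, primes := Set.univ, grp := fun _ => A,
      outerHom := fun f => nomatch f }
  refine ⟨{ Base := PUnit.{u + 1}
            fld := fun _ => ULift.{u} ℚ
            instField := fun _ => inferInstance
            instCharZero := fun _ => inferInstance
            datum := fun _ => D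
            Mem := fun _ _ => True
            IsHyperbolicOrbicurve := fun _ _ => True
            isHyperbolicOrbicurve_of_isHyperbolicCurve := fun _ _ _ => trivial
            chainTerms := fun _ _ => ∅ }, fun _ _ => trivial, ?_, fun h => ?_⟩
  · intro _ _ _ _ ht
    exact ht.elim
  · -- the identity outer homomorphism is an isomorphism, hence should have a preimage: it has none
    have hiso : OuterHom.mk ι ∈ {c : A.OuterHom A | c.IsIso} := by
      show (OuterHom.mk ι).IsIso
      rw [OuterHom.isIso_mk]
      exact Function.bijective_id
    obtain ⟨f, -, -⟩ := (h PUnit.unit PUnit.unit PUnit.unit trivial trivial).surjOn hiso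
    exact PEmpty.elim f

/-- **FACT-LIST F-0197, universal closure REFUTED**: it is NOT the case that every class of construction
data satisfies the rel-isom-DGC of [AbsTopI] Def 4.6 (ii).  Admissible form: per class, as the hypothesis
`(h : 𝒟.RelIsomDGC)`, or via the proved reduction `relIsomDGC_of_relHomDGC` for functorial data (for the
class of Example 4.8 (i)/(ii): [Tpcs] Thm 4.12 / [pGC] Thm A on curve members).
[cite: MochizukiAbsTopI2012, Def 4.6 (ii) p.56] -/
theorem not_forall_relIsomDGC :
    ¬ ∀ 𝒟 : ConstructionDataClass.{u},
      Literature.AnabelianGeometry.AbsoluteAnabelian.AbsTopI.ConstructionDataClass.RelIsomDGC 𝒟 := by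
  obtain ⟨𝒟, -, -, h⟩ := exists_not_relIsomDGC.{u}
  exact fun H => h (H 𝒟)

/-! ### F-0194: the universal closure of `Ex_4_8_ii` is false (for every prime) -/

/-- **F-0194 as a schema is false at an explicit class satisfying its typed hypothesis**: for every prime
`p`, the one-field class over `ℚ` with NO scheme morphisms (every object a member and a hyperbolic
orbicurve, `Σ = Primes`, no chain terms) SATISFIES `IsEx48ClassSub p` — `ℚ` is sub-`p`-adic — and is
chain-full, but violates the rel-hom-DGC clause of `Ex_4_8_ii p`.  (The class print speaks about is the
étale-`π₁` class of hyperbolic orbicurves over sub-`p`-adic fields, where the clause is [pGC] Thm A; the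
interface `IsEx48ClassSub` pins the fields, `Σ` and the membership predicate, not the datum.)
[cite: MochizukiAbsTopI2012, Ex 4.8 (ii) p.58] -/
theorem exists_isEx48ClassSub_not_ex_4_8_ii (p : ℕ) [Fact p.Prime] :
    ∃ 𝒟 : ConstructionDataClass.{u}, Nonempty 𝒟.Base ∧ 𝒟.IsEx48ClassSub p ∧ 𝒟.IsChainFull ∧
      ¬ Literature.AnabelianGeometry.AbsoluteAnabelian.AbsTopI.ConstructionDataClass.Ex_4_8_ii 𝒟 p := by
  haveI : CharZero (ULift.{u} ℚ) := charZero_ulift_rat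
  let G : ProfiniteGrp.{u} := absoluteGaloisGrp (ULift.{u} ℚ)
  let A : AugmentedProfiniteGrp G :=
    { arith := G, aug := ContinuousMonoidHom.id G, aug_surjective := Function.surjective_id }
  let ι : A.HomOver A := ⟨ContinuousMonoidHom.id _, fun _ => rfl⟩
  let D : RelativeAnabelianDatum G :=
    { Obj := PUnit.{u + 1}, Hom := fun _ _ => PEmpty.{u + 1}, IsIso := fun _ => True,
      IsHyperbolicCurve := fun _ => True, primes := Set.univ, grp := fun _ => A,
      outerHom := fun f => nomatch f }
  refine ⟨{ Base := PUnit.{u + 1}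
            fld := fun _ => ULift.{u} ℚ
            instField := fun _ => inferInstance
            instCharZero := fun _ => inferInstance
            datum := fun _ => D
            Mem := fun _ _ => True
            IsHyperbolicOrbicurve := fun _ _ => True
            isHyperbolicOrbicurve_of_isHyperbolicCurve := fun _ _ _ => trivial
            chainTerms := fun _ _ => ∅ }, ⟨PUnit.unit⟩,
          ⟨fun _ => isSubpadicFor_ulift_rat p, fun _ => rfl, fun _ _ => Iff.rfl⟩, ?_, fun h => ?_⟩
  · intro _ _ _ _ ht
    exact ht.elim
  · have hGC := (h ⟨fun _ => isSubpadicFor_ulift_rat p, fun _ => rfl, fun _ _ => Iff.rfl⟩).2.1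
    have hopen : OuterHom.mk ι ∈ {c : A.OuterHom A | c.IsOpen} := by
      show (OuterHom.mk ι).IsOpen
      have hr : Set.range ι.toHom = Set.univ := Set.range_eq_univ.mpr Function.surjective_id
      rw [OuterHom.isOpen_mk, HomOver.IsOpenHom, hr]
      exact isOpen_univ
    obtain ⟨f, -, -⟩ := (hGC PUnit.unit PUnit.unit PUnit.unit trivial trivial).surjOn hopen
    exact PEmpty.elim f

/-- **FACT-LIST F-0194, universal closure REFUTED at every prime**: for no prime `p` does every class of
construction data satisfy `Ex_4_8_ii p`.  Admissible form of the row: per class, via the proved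
reduction `ex_4_8_ii_of_relHomDGC` (chain-fullness + the rel-hom-DGC of THAT class; the cyclotomic and
slimness clauses are kernel theorems) or `ex_4_8_ii_of_thmA` ([pGC] Thm A field by field, curve members).
[cite: MochizukiAbsTopI2012, Ex 4.8 (ii) p.58] -/
theorem not_forall_ex_4_8_ii_prime (p : ℕ) [Fact p.Prime] :
    ¬ ∀ 𝒟 : ConstructionDataClass.{u},
      Literature.AnabelianGeometry.AbsoluteAnabelian.AbsTopI.ConstructionDataClass.Ex_4_8_ii 𝒟 p := by
  obtain ⟨𝒟, -, -, -, h⟩ := exists_isEx48ClassSub_not_ex_4_8_ii.{u} p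
  exact fun H => h (H 𝒟)

/-- **FACT-LIST F-0194, universal closure REFUTED** (fully quantified form, all universes): it is NOT the
case that `Ex_4_8_ii` holds for every class and every prime (witness: `p = 2`).
[cite: MochizukiAbsTopI2012, Ex 4.8 (ii) p.58] -/
theorem not_forall_ex_4_8_ii :
    ¬ ∀ (𝒟 : ConstructionDataClass.{u}) (p : ℕ) [Fact p.Prime],
      Literature.AnabelianGeometry.AbsoluteAnabelian.AbsTopI.ConstructionDataClass.Ex_4_8_ii 𝒟 p :=
  fun H => not_forall_ex_4_8_ii_prime.{u} 2 fun 𝒟 => H 𝒟 2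

/-! ### Tightness of the proved reductions -/

/-- **The functoriality datum of `relIsomDGC_of_relHomDGC` cannot be dropped**: at the interface level
the rel-hom-DGC does NOT imply the rel-isom-DGC — the one-field point class over `ℚ` with ONE scheme
endomorphism, flagged NOT an isomorphism and mapped to the identity outer homomorphism of
`Π = G_ℚ ↠ G_ℚ`, satisfies the rel-hom-DGC (over the point every outer homomorphism is `[id]`,
`AugmentedProfiniteGrp.outerHom_point_eq`) while the identity outer ISOmorphism has no preimage among
the (absent) isomorphisms.  ([pGC] p. 3 remark (3) "manifestly a special case" uses functoriality, as
`RelativeGCFunctoriality.lean` records.) [cite: MochizukiAbsTopI2012, Def 4.6 (ii) p.56] -/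
theorem exists_relHomDGC_not_relIsomDGC :
    ∃ 𝒟 : ConstructionDataClass.{u}, (∀ b X, 𝒟.Mem b X) ∧ 𝒟.IsChainFull ∧ 𝒟.RelHomDGC ∧
      ¬ Literature.AnabelianGeometry.AbsoluteAnabelian.AbsTopI.ConstructionDataClass.RelIsomDGC 𝒟 := by
  haveI : CharZero (ULift.{u} ℚ) := charZero_ulift_rat
  let G : ProfiniteGrp.{u} := absoluteGaloisGrp (ULift.{u} ℚ)
  let A : AugmentedProfiniteGrp G :=
    { arith := G, aug := ContinuousMonoidHom.id G, aug_surjective := Function.surjective_id }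
  let ι : A.HomOver A := ⟨ContinuousMonoidHom.id _, fun _ => rfl⟩
  -- one endomorphism, declared NOT an isomorphism, inducing the identity outer homomorphism
  let D : RelativeAnabelianDatum G :=
    { Obj := PUnit.{u + 1}, Hom := fun _ _ => PUnit.{u + 1}, IsIso := fun _ => False,
      IsHyperbolicCurve := fun _ => True, primes := Set.univ, grp := fun _ => A,
      outerHom := fun _ => OuterHom.mk ι }
  refine ⟨{ Base := PUnit.{u + 1}
            fld := fun _ => ULift.{u} ℚ
            instField := fun _ => inferInstance
            instCharZero := fun _ => inferInstance
            datum := fun _ => D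
            Mem := fun _ _ => True
            IsHyperbolicOrbicurve := fun _ _ => True
            isHyperbolicOrbicurve_of_isHyperbolicCurve := fun _ _ _ => trivial
            chainTerms := fun _ _ => ∅ }, fun _ _ => trivial, ?_, ?_, fun h => ?_⟩
  · intro _ _ _ _ ht
    exact ht.elim
  · -- rel-hom-DGC: `OuterHom` over the point is the singleton `{[id]}`, and `[id]` is open
    intro _ _ _ _ _
    refine ⟨fun _ _ => ?_, fun _ _ _ _ _ => Subsingleton.elim _ _, fun _ _ => ⟨PUnit.unit, trivial, ?_⟩⟩
    · show (OuterHom.mk ι).IsOpen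
      have hr : Set.range ι.toHom = Set.univ := Set.range_eq_univ.mpr Function.surjective_id
      rw [OuterHom.isOpen_mk, HomOver.IsOpenHom, hr]
      exact isOpen_univ
    · exact AugmentedProfiniteGrp.outerHom_point_eq _ _
  · -- rel-isom-DGC fails: `[id]` is an outer isomorphism without an isomorphism preimage
    have hiso : OuterHom.mk ι ∈ {c : A.OuterHom A | c.IsIso} := by
      show (OuterHom.mk ι).IsIso
      rw [OuterHom.isIso_mk]
      exact Function.bijective_id
    obtain ⟨f, hf, -⟩ := (h PUnit.unit PUnit.unit PUnit.unit trivial trivial).surjOn hiso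
    exact hf

/-- **The chain-fullness hypothesis of `ex_4_8_ii_of_relHomDGC` is not implied by the other typed
clauses**: for every prime `p` there is a class satisfying `IsEx48ClassSub p` and the rel-hom-DGC that is
NOT chain-full — one field `ℚ`, two objects over the point `Π = G_ℚ ↠ G_ℚ` of which exactly one is
(flagged) a hyperbolic orbicurve, hence a member, and whose chain terms contain the other.  (In print
"it is immediate that `𝒟` is chain-full" is a property of the scheme-side `X̃/X`-chains, which the
interface field `chainTerms` leaves abstract.) [cite: MochizukiAbsTopI2012, Ex 4.8 (ii) p.58] -/
theorem exists_isEx48ClassSub_relHomDGC_not_isChainFull (p : ℕ) [Fact p.Prime] :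
    ∃ 𝒟 : ConstructionDataClass.{u}, 𝒟.IsEx48ClassSub p ∧ 𝒟.RelHomDGC ∧
      ¬ Literature.AnabelianGeometry.AbsoluteAnabelian.AbsTopI.ConstructionDataClass.IsChainFull 𝒟 := by
  haveI : CharZero (ULift.{u} ℚ) := charZero_ulift_rat
  let G : ProfiniteGrp.{u} := absoluteGaloisGrp (ULift.{u} ℚ)
  let A : AugmentedProfiniteGrp G :=
    { arith := G, aug := ContinuousMonoidHom.id G, aug_surjective := Function.surjective_id }
  let ι : A.HomOver A := ⟨ContinuousMonoidHom.id _, fun _ => rfl⟩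
  -- two objects (`true` = the orbicurve member, `false` = a chain term that is not a member)
  let D : RelativeAnabelianDatum G :=
    { Obj := ULift.{u} Bool, Hom := fun _ _ => PUnit.{u + 1}, IsIso := fun _ => True,
      IsHyperbolicCurve := fun _ => False, primes := Set.univ, grp := fun _ => A,
      outerHom := fun _ => OuterHom.mk ι }
  refine ⟨{ Base := PUnit.{u + 1}
            fld := fun _ => ULift.{u} ℚ
            instField := fun _ => inferInstance
            instCharZero := fun _ => inferInstance
            datum := fun _ => D
            Mem := fun _ X => ULift.down X = true
            IsHyperbolicOrbicurve := fun _ X => ULift.down X = true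
            isHyperbolicOrbicurve_of_isHyperbolicCurve := fun _ _ h => False.elim h
            chainTerms := fun b _ => {⟨b, ULift.up false⟩} },
          ⟨fun _ => isSubpadicFor_ulift_rat p, fun _ => rfl, fun _ _ => Iff.rfl⟩, ?_, fun h => ?_⟩
  · -- rel-hom-DGC over the point, as in `exists_relHomDGC_not_relIsomDGC`
    intro _ _ _ _ _
    refine ⟨fun _ _ => ?_, fun _ _ _ _ _ => Subsingleton.elim _ _, fun _ _ => ⟨PUnit.unit, trivial, ?_⟩⟩
    · show (OuterHom.mk ι).IsOpen
      have hr : Set.range ι.toHom = Set.univ := Set.range_eq_univ.mpr Function.surjective_id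
      rw [OuterHom.isOpen_mk, HomOver.IsOpenHom, hr]
      exact isOpen_univ
    · exact AugmentedProfiniteGrp.outerHom_point_eq _ _
  · -- the chain term `false` of the member `true` is not a member
    have hmem := (h PUnit.unit (ULift.up true) rfl ⟨PUnit.unit, ULift.up false⟩ (Set.mem_singleton _)).1
    exact Bool.false_ne_true hmem

/-! ### Instance form / non-vacuity: `Ex_4_8_ii` at the one-field point class over `ℚ` -/

/-- **F-0194 / F-0196 / F-0197, instance form at the one-field POINT class over `ℚ`** (DEGENERATE:
`Δ = 1`): for every prime `p`, the class with one base field `ℚ`, one object over the point extension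
`Π = G_ℚ ↠ G_ℚ` with one scheme morphism (the identity, an isomorphism), every object a member and a
hyperbolic orbicurve, `Σ = Primes`, no chain terms, SATISFIES the typed hypothesis `IsEx48ClassSub p` of
[AbsTopI] Example 4.8 (ii) NON-VACUOUSLY (nonempty base, `ℚ` sub-`p`-adic) together with: chain-fullness,
the rel-hom-DGC and the rel-isom-DGC (over the point every outer homomorphism is `[id]`, which is open and
an isomorphism), and hence `Ex_4_8_ii p` itself — its cyclotomic clause (`χ_p : G_ℚ → ℤ_p^×` open) and
slimness clause (`G_ℚ` slim) being the cell's kernel theorems packaged in `ex_4_8_ii_of_relHomDGC`.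
A joint-satisfiability / instance witness; nothing about hyperbolic curves is asserted.
[cite: MochizukiAbsTopI2012, Ex 4.8 (ii) p.58] -/
theorem exists_isEx48ClassSub_ex_4_8_ii (p : ℕ) [Fact p.Prime] :
    ∃ 𝒟 : ConstructionDataClass.{u}, Nonempty 𝒟.Base ∧ (∀ b, Nonempty (𝒟.datum b).Obj) ∧
      (∀ b X, 𝒟.Mem b X) ∧ 𝒟.IsEx48ClassSub p ∧ 𝒟.IsChainFull ∧ 𝒟.RelHomDGC ∧ 𝒟.RelIsomDGC ∧
      Literature.AnabelianGeometry.AbsoluteAnabelian.AbsTopI.ConstructionDataClass.Ex_4_8_ii 𝒟 p := by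
  haveI : CharZero (ULift.{u} ℚ) := charZero_ulift_rat
  let G : ProfiniteGrp.{u} := absoluteGaloisGrp (ULift.{u} ℚ)
  let A : AugmentedProfiniteGrp G :=
    { arith := G, aug := ContinuousMonoidHom.id G, aug_surjective := Function.surjective_id }
  let ι : A.HomOver A := ⟨ContinuousMonoidHom.id _, fun _ => rfl⟩
  -- one object, one scheme morphism (the identity, an isomorphism) mapped to `[id]`
  let D : RelativeAnabelianDatum G :=
    { Obj := PUnit.{u + 1}, Hom := fun _ _ => PUnit.{u + 1}, IsIso := fun _ => True,
      IsHyperbolicCurve := fun _ => True, primes := Set.univ, grp := fun _ => A,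
      outerHom := fun _ => OuterHom.mk ι }
  let 𝒟 : ConstructionDataClass.{u} :=
    { Base := PUnit.{u + 1}
      fld := fun _ => ULift.{u} ℚ
      instField := fun _ => inferInstance
      instCharZero := fun _ => inferInstance
      datum := fun _ => D
      Mem := fun _ _ => True
      IsHyperbolicOrbicurve := fun _ _ => True
      isHyperbolicOrbicurve_of_isHyperbolicCurve := fun _ _ _ => trivial
      chainTerms := fun _ _ => ∅ }
  have hopen : (OuterHom.mk ι).IsOpen := by
    have hr : Set.range ι.toHom = Set.univ := Set.range_eq_univ.mpr Function.surjective_id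
    rw [OuterHom.isOpen_mk, HomOver.IsOpenHom, hr]
    exact isOpen_univ
  have hiso : (OuterHom.mk ι).IsIso := by
    rw [OuterHom.isIso_mk]
    exact Function.bijective_id
  have hfull : 𝒟.IsChainFull := fun _ _ _ _ ht => ht.elim
  have hHom : 𝒟.RelHomDGC := fun _ _ _ _ _ =>
    ⟨fun _ _ => hopen, fun _ _ _ _ _ => Subsingleton.elim _ _,
      fun _ _ => ⟨PUnit.unit, trivial, AugmentedProfiniteGrp.outerHom_point_eq _ _⟩⟩
  have hIsom : 𝒟.RelIsomDGC := fun _ _ _ _ _ =>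
    ⟨fun _ _ => hiso, fun _ _ _ _ _ => Subsingleton.elim _ _,
      fun _ _ => ⟨PUnit.unit, trivial, AugmentedProfiniteGrp.outerHom_point_eq _ _⟩⟩
  exact ⟨𝒟, ⟨PUnit.unit⟩, fun _ => ⟨PUnit.unit⟩, fun _ _ => trivial,
    ⟨fun _ => isSubpadicFor_ulift_rat p, fun _ => rfl, fun _ _ => Iff.rfl⟩, hfull, hHom, hIsom,
    ex_4_8_ii_of_relHomDGC hfull hHom⟩

/-! ### Appended (abc-iut-f-057, after p428332): what the rows amount to AT A NAMED CLASS

The RESIDUAL FORM of F-0194 (companion of abc-iut-f-056's `ex_4_8_i_iff` for F-0193,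
`RelativeGCEx48Residual.lean`): `Ex_4_8_ii p` holds for `𝒟` iff, granted `IsEx48ClassSub p`, `𝒟` is
chain-full and satisfies the rel-hom-DGC (`ex_4_8_ii_iff`) — the cyclotomic and slimness clauses being
kernel theorems; for a class of hyperbolic CURVES it is chain-fullness alone once the datum-level hom-GC
`RelativeAnabelianDatum.RelHomGC` (FACT-LIST F-1792, the conclusion of [pGC] Thm A) resp. the named fact
`pGC.ThmA` (F-1794) is granted field by field (`ex_4_8_ii_iff_isChainFull_of_relHomGC`,
`ex_4_8_ii_iff_isChainFull_of_thmA`).  The class-level predicates F-0196 / F-0197 follow from the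
datum-level GC properties whenever members are hyperbolic curves (`relHomDGC_of_relHomGC`,
`relIsomDGC_of_relIsomGC`) — the by-name links a layer certificate binds instead of the refuted closures. -/

section Residual

variable {𝒟 : ConstructionDataClass.{u}}

/-- **F-0196 from the datum-level hom-GC**: if every member of `𝒟` is a hyperbolic curve of its datum
and each datum `𝒟.datum b` has the relative hom-version GC property (`RelativeAnabelianDatum.RelHomGC`,
the conclusion of [pGC] Thm A over `k_b`), then the rel-hom-DGC holds for `𝒟` ([AbsTopI] Ex 4.8 (ii)
p. 58: "the rel-hom-DGC follows from [Mzk3], Theorem A"). [cite: MochizukiAbsTopI2012, Def 4.6 (ii) p.56] -/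
theorem relHomDGC_of_relHomGC (hmem : ∀ b X, 𝒟.Mem b X → (𝒟.datum b).IsHyperbolicCurve X)
    (h : ∀ b, (𝒟.datum b).RelHomGC) :
    Literature.AnabelianGeometry.AbsoluteAnabelian.AbsTopI.ConstructionDataClass.RelHomDGC 𝒟 :=
  fun b X₁ X₂ _ h₂ => h b X₁ X₂ (hmem b X₂ h₂)

/-- **F-0197 from the datum-level isom-GC**: if every member of `𝒟` is a hyperbolic curve of its datum
and each datum has the relative isom-version GC property (`RelativeAnabelianDatum.RelIsomGC`, the
conclusion of [Tpcs] Thm 4.12 / of [pGC] Thm A remark (3)), then the rel-isom-DGC holds for `𝒟`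
([AbsTopI] Ex 4.8 (i) p. 58). [cite: MochizukiAbsTopI2012, Def 4.6 (ii) p.56] -/
theorem relIsomDGC_of_relIsomGC (hmem : ∀ b X, 𝒟.Mem b X → (𝒟.datum b).IsHyperbolicCurve X)
    (h : ∀ b, (𝒟.datum b).RelIsomGC) :
    Literature.AnabelianGeometry.AbsoluteAnabelian.AbsTopI.ConstructionDataClass.RelIsomDGC 𝒟 :=
  fun b X₁ X₂ h₁ h₂ => h b X₁ X₂ (hmem b X₁ h₁) (hmem b X₂ h₂)

/-- **[AbsTopI] Example 4.8 (ii), RESIDUAL FORM** (F-0194 at a named class): the named fact `Ex_4_8_ii`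
holds for `𝒟` iff, granted that `𝒟` is the Example-4.8 (ii) class (`IsEx48ClassSub p`), `𝒟` is
chain-full and satisfies the rel-hom-DGC — the cyclotomic clause ("`p` serves as `l`") and the slimness
clause ([pGC] Lem 15.8) being kernel theorems for sub-`p`-adic fields (`cyclotomic_of_isEx48ClassSub`,
`slim_of_isEx48ClassSub`). [cite: MochizukiAbsTopI2012, Ex 4.8 (ii) p.58] -/
theorem ex_4_8_ii_iff {p : ℕ} [Fact p.Prime] :
    Literature.AnabelianGeometry.AbsoluteAnabelian.AbsTopI.ConstructionDataClass.Ex_4_8_ii 𝒟 p ↔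
      (𝒟.IsEx48ClassSub p → 𝒟.IsChainFull ∧ 𝒟.RelHomDGC) :=
  ⟨fun h h𝒟 => ⟨(h h𝒟).1, (h h𝒟).2.1⟩,
    fun h h𝒟 => ⟨(h h𝒟).1, (h h𝒟).2, cyclotomic_of_isEx48ClassSub h𝒟, slim_of_isEx48ClassSub h𝒟⟩⟩

/-- For an Example-4.8 (ii) class, `Ex_4_8_ii` says exactly: chain-full and rel-hom-DGC.
[cite: MochizukiAbsTopI2012, Ex 4.8 (ii) p.58] -/
theorem ex_4_8_ii_iff_of_isEx48ClassSub {p : ℕ} [Fact p.Prime] (h𝒟 : 𝒟.IsEx48ClassSub p) :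
    Literature.AnabelianGeometry.AbsoluteAnabelian.AbsTopI.ConstructionDataClass.Ex_4_8_ii 𝒟 p ↔
      𝒟.IsChainFull ∧ 𝒟.RelHomDGC :=
  ex_4_8_ii_iff.trans ⟨fun h => h h𝒟, fun h _ => h⟩

/-- For a class all of whose members are hyperbolic CURVES whose data satisfy the hom-version GC
(`RelativeAnabelianDatum.RelHomGC` field by field), `Ex_4_8_ii` is EQUIVALENT to chain-fullness (given
`IsEx48ClassSub p`). [cite: MochizukiAbsTopI2012, Ex 4.8 (ii) p.58] -/
theorem ex_4_8_ii_iff_isChainFull_of_relHomGC {p : ℕ} [Fact p.Prime]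
    (hcurve : ∀ b X, 𝒟.Mem b X → (𝒟.datum b).IsHyperbolicCurve X)
    (hGC : ∀ b, (𝒟.datum b).RelHomGC) :
    Literature.AnabelianGeometry.AbsoluteAnabelian.AbsTopI.ConstructionDataClass.Ex_4_8_ii 𝒟 p ↔
      (𝒟.IsEx48ClassSub p → 𝒟.IsChainFull) :=
  ⟨fun h h𝒟 => (h h𝒟).1, fun h h𝒟 =>
    ⟨h h𝒟, relHomDGC_of_relHomGC hcurve hGC, cyclotomic_of_isEx48ClassSub h𝒟,
      slim_of_isEx48ClassSub h𝒟⟩⟩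

/-- For a class of hyperbolic CURVES over sub-`p`-adic fields, `Ex_4_8_ii` is EQUIVALENT to
chain-fullness once the named fact [pGC] Thm A (`pGC.ThmA`, FACT-LIST F-1794) is granted field by field
— the printed inputs of Example 4.8 (ii) with every field-side clause discharged (compare
`ex_4_8_ii_of_thmA`, the forward direction). [cite: MochizukiAbsTopI2012, Ex 4.8 (ii) p.58] -/
theorem ex_4_8_ii_iff_isChainFull_of_thmA {p : ℕ} [Fact p.Prime]
    (hcurve : ∀ b X, 𝒟.Mem b X → (𝒟.datum b).IsHyperbolicCurve X)
    (hGC : ∀ b, pGC.ThmA (𝒟.fld b) (𝒟.datum b)) :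
    Literature.AnabelianGeometry.AbsoluteAnabelian.AbsTopI.ConstructionDataClass.Ex_4_8_ii 𝒟 p ↔
      (𝒟.IsEx48ClassSub p → 𝒟.IsChainFull) :=
  ⟨fun h h𝒟 => (h h𝒟).1, fun h h𝒟 => ex_4_8_ii_of_thmA (h h𝒟) hcurve hGC h𝒟⟩

end Residual

end Literature.AnabelianGeometry.AbsoluteAnabelian.AbsTopI.ConstructionDataClass
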